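/- Copyright: the b2b-balaban cell (near-miss cell 7), T⁴-continuum fan-out; row NE7b ROUND-2 swarm, seat
t4-ne7b-formalise-leaf-06 (gen 5) (road W-RP, supplier «W3g» file 1 of 2: the cell's level-0 Gibbs state read through the
dictionary; INTENT journal l.15271).  Released under the licence of the surrounding project. -/
import Summits.QuantumFields.BalabanUV.T4Continuum.Support.HistoryRPHalfTorus
import Literature.MathematicalPhysics.QuantumFieldTheory.Balaban1983to89.TorusReflectionPositivity
import Literature.MathematicalPhysics.QuantumFieldTheory.Balaban1983to89.T4GenFunBounds

/-!
# Road W-RP, supplier «W3g» (file 1): the cell's level-0 Gibbs state IS the tree's torus Wilson state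

Summits-side support leaf of the T⁴-continuum cell (rung (B)+1 on a FINITE torus only; NOT infinite volume, NOT the
mass gap, NOT the Clay statement; NOT a proof of the spine estimate NE7b).  Row NE7b, road **W-RP** (owner rulings
R-OWNER-23-2 ∕ R-OWNER-23-8), the piece reserved for this lineage by leaf-06 g4 (journal l.14995 (iii)) and left
DISPLAYED by sub-row W3f (leaf-04 g6, l.15071) and by W3c's header («WHAT IT BUYS» (a): «the identification of the run's
fine-link state with `wilsonMeasure ρ β` on the tree's `GaugeConfig d L G` … a DISPLAYED sentence — the cell's `Setup`
tori are a different vocabulary»).  [folklore] bookkeeping over the cell's OWN definitions and dictionary, consumed BY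
NAME: the level-0 law `T4GenFunBounds.gibbsMeasure P β = Z⁻¹ e^{−βA} ∏_b dU(b)` (= `T4Assembly`'s `μ_K`,
`T4CanonicalTiltRate`'s Wilson Gibbs measures), the exact expectation symmetries `Missing.IsExpectSymmetry`
(`TorusHypercubicSymmetry`, `T4Covariance`), the dictionary `TorusReflectionPositivity.{toConfig, ofConfig,
measurePreserving_ofConfig, wilsonAction_toConfig}`, W3f file 1 `HistoryRPHalfTorus.measurable_creflect`.  No `def`, no
`structure`, no `[cite:]` tag, nothing printed asserted, no estimate of [B12]–[B16] used.

WHAT.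
* §1 **`measurePreserving_gibbsMeasure_of_isExpectSymmetry`**: a measurable EXACT expectation symmetry `Φ`
  (`⟨F ∘ Φ⟩_{P,β} = ⟨F⟩_{P,β}` for every `F`) PRESERVES `gibbsMeasure P β` (`β ≥ 0`; test on indicators through
  `integral_gibbsMeasure_eq_expect`); hence the centre reflections `GaugeField.creflect ρ` of [B12] (2.17) preserve it
  (`measurePreserving_creflect` — W3b's binder shape `MeasurePreserving θ μ μ` at level 0).
* §2 THE STATE DICTIONARY under EXACTLY the group hypotheses of `TorusReflectionPositivity` (`HaarData` = normalised Haar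
  `hhaar`, `reTr = Re tr ϱ ∕ N` for a matrix representation `ϱ` (`hre`), `N ≠ 0`): `boltzmann_ofConfig`
  (`e^{−βA(ofConfig V)} = e^{−(β∕N)S(V)}`), `setLIntegral_boltzmann_eq` ∕ `lintegral_boltzmann_eq` (change of variables on
  preimages of `toConfig`), `ofReal_partitionFn_eq` (the two partition functions), and
  **`map_toConfig_gibbsMeasure : (gibbsMeasure P β).map toConfig = wilsonMeasure ϱ (β ∕ N)`** on
  `GaugeConfig P.d (P.sitesPerDir 0) G`, packaged as `measurePreserving_toConfig`.  File 2 (`HistoryRPGibbs`) transports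
  W3c's base RP-package back along this map.

HONEST SCOPE (c4).  Measure-theoretic bookkeeping; the identification «the run's level-0 law is `gibbsMeasure (F.P K) β_K`»
is the cell's own DEFINITION of its torus schemes, not a reading of Bałaban; nothing of W4b′'s `CutoffReading` for the
EXTENDED state (levels `≥ 1`: W3b ∕ W3d ∕ W3f), nothing of (EXT)∕(LOC)∕(R-sym)∕(U1)∕(G2), nothing of H3 ∕ (B) ∕ BetaPertH
is discharged; no exit ∕ socket ∕ `HistoryConstants` ∕ END touched (c3), no `Prop` fact minted (c1), no constant (c2∕c6).
NE7b NOT proved; spine 0∕9.  HONEST DEPENDENCY (cell): continuum YM on T⁴ ⇐ BetaPertH ∧ nine spine estimates (0/9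
proved); BetaPertH ⇐ (D1) ∧ (D4) ∧ CAP+tail; G-an2-4 gates asym, D1 and NE2/3/4.  This file changes none of it.
-/

open MeasureTheory
open Literature.MathematicalPhysics.QuantumFieldTheory
open Literature.MathematicalPhysics.QuantumFieldTheory.Balaban1983to89
open Summit.QuantumFields.BalabanUV.T4Continuum.HistoryRPHalfTorus (measurable_creflect)

namespace Summit.QuantumFields.BalabanUV.T4Continuum.HistoryRPGibbsState

noncomputable section

/-! ## §1 `Setup` side: exact expectation symmetries preserve the Gibbs state -/

section SetupSide

variable {P : Params} {G : Type*} [GaugeGroup G] [MeasurableSpace G] [RegularGaugeGroup G] [HaarData G]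

/-- **AN EXACT EXPECTATION SYMMETRY PRESERVES THE GIBBS STATE.**  If `Φ` is measurable and `⟨F ∘ Φ⟩_{P,β} = ⟨F⟩_{P,β}`
for every `F` (`Missing.IsExpectSymmetry`, tree `TorusHypercubicSymmetry`: translations, coordinate permutations, axis
reflections, and their composites), then `Φ` preserves `gibbsMeasure P β` (`β ≥ 0`): test on indicators
(`integral_gibbsMeasure_eq_expect`). [folklore] -/
theorem measurePreserving_gibbsMeasure_of_isExpectSymmetry {β : ℝ} (hβ : 0 ≤ β)
    {Φ : GaugeField P 0 G → GaugeField P 0 G} (hΦm : Measurable Φ) (hΦ : Missing.IsExpectSymmetry P β Φ) :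
    MeasurePreserving Φ (T4GenFunBounds.gibbsMeasure (G := G) P β) (T4GenFunBounds.gibbsMeasure (G := G) P β) := by
  haveI := T4GenFunBounds.isProbabilityMeasure_gibbsMeasure (G := G) P hβ
  refine ⟨hΦm, Measure.ext fun s hs => ?_⟩
  rw [Measure.map_apply hΦm hs]
  have h1 : (T4GenFunBounds.gibbsMeasure (G := G) P β).real (Φ ⁻¹' s) =
      (T4GenFunBounds.gibbsMeasure (G := G) P β).real s := by
    rw [← integral_indicator_one (hΦm hs), ← integral_indicator_one hs]
    have hind : (fun U : GaugeField P 0 G => (Φ ⁻¹' s).indicator (1 : GaugeField P 0 G → ℝ) U) =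
        fun U => s.indicator (1 : GaugeField P 0 G → ℝ) (Φ U) := by
      funext U
      by_cases hU : Φ U ∈ s
      · rw [Set.indicator_of_mem (show U ∈ Φ ⁻¹' s from hU), Set.indicator_of_mem hU]
        rfl
      · rw [Set.indicator_of_notMem (show U ∉ Φ ⁻¹' s from hU), Set.indicator_of_notMem hU]
    rw [hind, T4GenFunBounds.integral_gibbsMeasure_eq_expect P hβ,
      T4GenFunBounds.integral_gibbsMeasure_eq_expect P hβ]
    exact hΦ _
  exact (ENNReal.toReal_eq_toReal_iff' (measure_ne_top _ _) (measure_ne_top _ _)).1 h1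

/-- The centre reflection `c_ρ` of axis `ρ` is an exact expectation symmetry (`T4Covariance`'s
`IsExpectSymmetry.creflect_translate` at the zero translation). [folklore] -/
theorem isExpectSymmetry_creflect (β : ℝ) (ρ : Fin P.d) :
    Missing.IsExpectSymmetry P β (GaugeField.creflect (P := P) (j := 0) (G := G) ρ) := by
  have h := Missing.IsExpectSymmetry.creflect_translate (G := G) P β ρ (0 : Site P 0)
  have hid : (fun U : GaugeField P 0 G => (U.translate (0 : Site P 0)).creflect ρ) = GaugeField.creflect ρ := by
    funext U
    rw [GaugeField.translate_zero]
  rwa [hid] at h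

/-- **THE CENTRE REFLECTIONS PRESERVE THE GIBBS STATE** (`β ≥ 0`; W3b's binder shape `MeasurePreserving θ μ μ` at
level 0). [folklore] -/
theorem measurePreserving_creflect {β : ℝ} (hβ : 0 ≤ β) (ρ : Fin P.d) :
    MeasurePreserving (GaugeField.creflect (P := P) (j := 0) (G := G) ρ)
      (T4GenFunBounds.gibbsMeasure (G := G) P β) (T4GenFunBounds.gibbsMeasure (G := G) P β) :=
  measurePreserving_gibbsMeasure_of_isExpectSymmetry hβ (measurable_creflect ρ) (isExpectSymmetry_creflect β ρ)

end SetupSide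

/-! ## §2 The state dictionary: `gibbsMeasure P β` read through `toConfig` IS the tree's `wilsonMeasure ϱ (β ∕ N)` -/

section State

variable {P : Params} {G : Type*} [GaugeGroup G] [MeasurableSpace G] [RegularGaugeGroup G] [HaarData G]
  [TopologicalSpace G] [IsTopologicalGroup G] [CompactSpace G] [BorelSpace G]
  {N : ℕ} (ϱ : G →* Matrix (Fin N) (Fin N) ℂ)

omit [MeasurableSpace G] [RegularGaugeGroup G] [HaarData G] [TopologicalSpace G] [IsTopologicalGroup G] [CompactSpace G]
  [BorelSpace G] in
/-- The Boltzmann weight through the dictionary: `e^{−βA(ofConfig V)} = e^{−(β∕N) S(V)}` (`wilsonAction_toConfig`: the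
tree's un-normalised action is `N·A`). [folklore] -/
theorem boltzmann_ofConfig (hN : N ≠ 0) (hre : ∀ g : G, reTr g * N = ((ϱ g).trace).re) (β : ℝ)
    (V : GaugeConfig P.d (P.sitesPerDir 0) G) :
    Missing.boltzmann P β (ofConfig V) =
      Real.exp (-(β / N) * Literature.MathematicalPhysics.QuantumFieldTheory.wilsonAction ϱ V) := by
  have hN' : (N : ℝ) ≠ 0 := Nat.cast_ne_zero.mpr hN
  have hS : Literature.MathematicalPhysics.QuantumFieldTheory.wilsonAction ϱ V =
      (N : ℝ) * wilsonAction4 (ofConfig V) := by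
    have h := wilsonAction_toConfig (j := 0) ϱ hre (ofConfig V)
    rwa [toConfig_ofConfig] at h
  rw [hS, Missing.boltzmann]
  congr 1
  field_simp

/-- **CHANGE OF VARIABLES FOR THE BOLTZMANN DENSITY ON PREIMAGES OF `toConfig`**: for measurable `s`,
`∫⁻_{toConfig⁻¹ s} e^{−βA} dU = ∫⁻_s e^{−(β∕N) S} ∏ dV_e` (`measurePreserving_ofConfig` + `boltzmann_ofConfig`; `toConfig ∘
ofConfig = id`). [folklore] -/
theorem setLIntegral_boltzmann_eq (hhaar : (HaarData.haar : Measure G) = haarProbability G) (hN : N ≠ 0)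
    (hre : ∀ g : G, reTr g * N = ((ϱ g).trace).re) (β : ℝ) {s : Set (GaugeConfig P.d (P.sitesPerDir 0) G)}
    (hs : MeasurableSet s) :
    ∫⁻ U in toConfig ⁻¹' s, ENNReal.ofReal (Missing.boltzmann P β U) ∂fieldMeasure P 0 G =
      ∫⁻ V in s, ENNReal.ofReal (Real.exp (-(β / N) * Literature.MathematicalPhysics.QuantumFieldTheory.wilsonAction ϱ V))
        ∂(Measure.pi fun _ : Edge P.d (P.sitesPerDir 0) => haarProbability G) := by
  have hmp := measurePreserving_ofConfig (P := P) (j := 0) (G := G) hhaar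
  have h := hmp.setLIntegral_comp_preimage (s := toConfig ⁻¹' s) (measurable_toConfig hs)
    (T4GenFunBounds.measurable_ofReal_boltzmann P β)
  have hpre : (ofConfig (P := P) (j := 0) (G := G)) ⁻¹' ((toConfig (P := P) (j := 0) (G := G)) ⁻¹' s) = s := by
    ext V
    simp only [Set.mem_preimage, toConfig_ofConfig]
  rw [hpre] at h
  rw [← h]
  refine setLIntegral_congr_fun hs (fun V _ => ?_)
  rw [boltzmann_ofConfig ϱ hN hre]

/-- The same over the whole space. [folklore] -/
theorem lintegral_boltzmann_eq (hhaar : (HaarData.haar : Measure G) = haarProbability G) (hN : N ≠ 0)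
    (hre : ∀ g : G, reTr g * N = ((ϱ g).trace).re) (β : ℝ) :
    ∫⁻ U, ENNReal.ofReal (Missing.boltzmann P β U) ∂fieldMeasure P 0 G =
      ∫⁻ V, ENNReal.ofReal (Real.exp (-(β / N) * Literature.MathematicalPhysics.QuantumFieldTheory.wilsonAction ϱ V))
        ∂(Measure.pi fun _ : Edge P.d (P.sitesPerDir 0) => haarProbability G) := by
  have h := setLIntegral_boltzmann_eq (P := P) ϱ hhaar hN hre β MeasurableSet.univ
  rwa [Set.preimage_univ, Measure.restrict_univ, Measure.restrict_univ] at h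

/-- **THE PARTITION FUNCTIONS CORRESPOND**: `Z_{P,β}` of `Missing` (a real) and the tree's `partitionFunction ϱ (β∕N)`
(an `ℝ≥0∞`), `β ≥ 0`. [folklore] -/
theorem ofReal_partitionFn_eq (hhaar : (HaarData.haar : Measure G) = haarProbability G) (hN : N ≠ 0)
    (hre : ∀ g : G, reTr g * N = ((ϱ g).trace).re) {β : ℝ} (hβ : 0 ≤ β) :
    ENNReal.ofReal (Missing.partitionFn (G := G) P β) = partitionFunction (d := P.d) (L := P.sitesPerDir 0) ϱ (β / N) := by
  rw [← T4GenFunBounds.lintegral_boltzmann P hβ, lintegral_boltzmann_eq (P := P) ϱ hhaar hN hre β, partitionFunction,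
    wilsonWeight, withDensity_apply _ MeasurableSet.univ, Measure.restrict_univ]

/-- **THE STATE DICTIONARY.**  The cell's level-0 Gibbs state `gibbsMeasure P β = Z⁻¹ e^{−βA} ∏_b dU(b)` on
`GaugeField P 0 G`, pushed forward along `toConfig`, IS the tree's torus Wilson state `wilsonMeasure ϱ (β∕N)` on
`GaugeConfig P.d (P.sitesPerDir 0) G` (`β ≥ 0`; group hypotheses of `TorusReflectionPositivity`: `HaarData` = normalised
Haar, `reTr = Re tr ϱ ∕ N`, `N ≠ 0`).  This is the sentence road W-RP displayed at level 0 («the run's fine-link state IS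
`wilsonMeasure` on `GaugeConfig`»). [folklore] -/
theorem map_toConfig_gibbsMeasure (hhaar : (HaarData.haar : Measure G) = haarProbability G) (hN : N ≠ 0)
    (hre : ∀ g : G, reTr g * N = ((ϱ g).trace).re) {β : ℝ} (hβ : 0 ≤ β) :
    (T4GenFunBounds.gibbsMeasure (G := G) P β).map toConfig =
      wilsonMeasure (d := P.d) (L := P.sitesPerDir 0) ϱ (β / N) := by
  ext s hs
  rw [Measure.map_apply measurable_toConfig hs, T4GenFunBounds.gibbsMeasure, Measure.smul_apply,
    withDensity_apply _ (measurable_toConfig hs), setLIntegral_boltzmann_eq (P := P) ϱ hhaar hN hre β hs,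
    ofReal_partitionFn_eq (P := P) ϱ hhaar hN hre hβ, wilsonMeasure, Measure.smul_apply, wilsonWeight,
    withDensity_apply _ hs]

/-- The dictionary as a measure-preserving map `toConfig : (gibbsMeasure P β) → (wilsonMeasure ϱ (β∕N))`. [folklore] -/
theorem measurePreserving_toConfig (hhaar : (HaarData.haar : Measure G) = haarProbability G)
    (hN : N ≠ 0) (hre : ∀ g : G, reTr g * N = ((ϱ g).trace).re) {β : ℝ} (hβ : 0 ≤ β) :
    MeasurePreserving (toConfig (P := P) (j := 0) (G := G)) (T4GenFunBounds.gibbsMeasure (G := G) P β)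
      (wilsonMeasure (d := P.d) (L := P.sitesPerDir 0) ϱ (β / N)) :=
  ⟨measurable_toConfig, map_toConfig_gibbsMeasure (P := P) ϱ hhaar hN hre hβ⟩

end State

/-! ### The `SU(N)` case (f1's `UnitaryModel` instances): no hypothesis on the group left -/

section SpecialUnitary

/-- **THE STATE DICTIONARY FOR `SU(N)`, HYPOTHESIS-FREE**: `HaarData` = normalised Haar by `rfl`, `reTr = Re tr ∕ N` by
`reTr_mul_card_SU`; the Gibbs state of `SU(N)` lattice gauge theory on Bałaban's `T^{(0)}` read through `toConfig` is the
tree's `wilsonMeasure (fundamentalRep (Fin N)) (β ∕ N)` (`β ≥ 0`). [folklore] -/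
theorem map_toConfig_gibbsMeasure_SU {n : ℕ} [NeZero n] (P : Params) {β : ℝ} (hβ : 0 ≤ β) :
    (T4GenFunBounds.gibbsMeasure (G := Matrix.specialUnitaryGroup (Fin n) ℂ) P β).map toConfig =
      wilsonMeasure (d := P.d) (L := P.sitesPerDir 0)
        (Literature.MathematicalPhysics.QuantumLattice.fundamentalRep (Fin n)) (β / n) :=
  map_toConfig_gibbsMeasure _ rfl (NeZero.ne n) reTr_mul_card_SU hβ

end SpecialUnitary

end

end Summit.QuantumFields.BalabanUV.T4Continuum.HistoryRPGibbsState
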